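import Mathlib
import Summits.RiemannHypothesis.RiemannHypothesis.Theorems.PfPersistenceAdmissibleClass
import Summits.RiemannHypothesis.RiemannHypothesis.Theorems.PfPersistenceF2PlantedIndex
import Summits.RiemannHypothesis.RiemannHypothesis.Theorems.PfPersistenceF2RealPairNodal

/-!
# PF persistence — fake-2: QUANTITATIVE NODAL DEPTH for planted real pairs (pub-rhpf fake-2 gen 3; helper)

**HONEST FRAMING. Mechanism / rigidity campaign; no RH claims.** Pure finite-dimensional analysis, RH-free.

`Theorems/PfPersistenceF2RealPairNodal.lean` proves: for a nonnegative form `Q` on `ℝ^{N+1}`, `σ ≥ 0` and an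
eigenvector `u ≠ 0` of `Q + σ c cᵀ` (`c = realPairVec η L N`, the even Gram vector of a planted REAL pair of zeros
`½ ± η`) with eigenvalue `λ < σ L / (2 (N+1))`, the profile `θ_u` takes BOTH signs on the window (exact nodality).

The cell's harness criterion is FLOOR-AWARE: it counts sign changes only among profile values exceeding `10⁻²⁰·max|θ|`.
This file makes the floor-aware reading a theorem too.  With the sup-norm bound `M_u := √((u ⬝ᵥ u)(N+1)(2/L)) ≥ |θ_u(x)|`
(`profile_sq_le`) and `G := cosh(η L/2) − 1`:

* `le_eigenvalue_of_floor` — if `θ_u ≥ −τ M_u` on the window (`0 ≤ τ`, `τ (1+τ+G) ≤ 1/(2(N+1))`) then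
  `2 σ (N+1) L (1/(2(N+1)) − τ(1+τ+G))² ≤ λ`; at `τ = 0` this is the one-signed bound `σ L/(2(N+1)) ≤ λ`.
* `exists_profile_lt_of_eigenvalue_lt` / `exists_profile_gt_of_eigenvalue_lt` — contrapositive, both orientations:
  `λ` below that threshold ⇒ `θ_u < −τ M_u` somewhere AND `θ_u > τ M_u` somewhere on the window, i.e. the node has
  RELATIVE DEPTH `> τ` measured against `M_u ≥ max|θ_u|` (hence a fortiori against `max|θ_u|`): `deepNodal`.
* `realPair_deepNodal_bottom` — Datum level, as in `realPair_not_mem_oneSignedAt`.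

Proof: for `−m ≤ θ ≤ M` pointwise `θ² ≤ M θ + m (M + m)`, so Parseval gives `u ⬝ᵥ u ≤ M ∫θ + m(M+m)L`; evenness of
`θ_u` gives `⟨c,u⟩ = ∫ θ cosh(ηx) ≥ ∫θ − m G L`; and `λ (u ⬝ᵥ u) ≥ σ ⟨c,u⟩²` (`sigma_sq_dot_le`).  [folklore]
-/

noncomputable section

namespace Summit.RiemannHypothesis.RiemannHypothesis.Theorems.PfPersistenceF2NodalDepth

open Matrix BigOperators Real MeasureTheory intervalIntegral Set
open Summit.RiemannHypothesis.RiemannHypothesis.Theorems.PfPersistence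
open Summit.RiemannHypothesis.RiemannHypothesis.Theorems.PfPersistenceF2PlantedIndex (vecMulVec_mulVec_eq)
open Summit.RiemannHypothesis.RiemannHypothesis.Theorems.PfPersistenceF2RealPairNodal

section Depth

variable (L : ℝ) {N : ℕ}

/-- The sup-norm bound of a profile: `M_u = √((u ⬝ᵥ u)·(N+1)·(2/L))`; `|θ_u(x)| ≤ M_u` (`abs_profile_le_supBound`). -/
def supBound (u : Fin (N + 1) → ℝ) : ℝ := Real.sqrt ((u ⬝ᵥ u) * ((N + 1) * (2 / L)))

/-- `M_u ≥ 0`. [folklore] -/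
theorem supBound_nonneg (u : Fin (N + 1) → ℝ) : 0 ≤ supBound L u := Real.sqrt_nonneg _

/-- `M_{-u} = M_u`. [folklore] -/
theorem supBound_neg (u : Fin (N + 1) → ℝ) : supBound L (-u) = supBound L u := by
  simp [supBound]

/-- `u ⬝ᵥ u > 0` for `u ≠ 0`. [folklore] -/
theorem dotProduct_self_pos {u : Fin (N + 1) → ℝ} (hu0 : u ≠ 0) : 0 < u ⬝ᵥ u := by
  rcases Function.ne_iff.mp hu0 with ⟨i, hi⟩
  have hi' : u i ≠ 0 := by simpa using hi
  have hsq : 0 < u i ^ 2 := by rw [sq]; exact mul_self_pos.mpr hi'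
  have : u ⬝ᵥ u = ∑ n, u n ^ 2 := by simp [dotProduct, sq]
  rw [this]
  exact lt_of_lt_of_le hsq (Finset.single_le_sum (fun n _ => sq_nonneg (u n)) (Finset.mem_univ i))

/-- `M_u² = (u ⬝ᵥ u)(N+1)(2/L)` for `0 < L`. [folklore] -/
theorem supBound_sq (hL : 0 < L) (u : Fin (N + 1) → ℝ) :
    supBound L u ^ 2 = (u ⬝ᵥ u) * ((N + 1) * (2 / L)) := by
  unfold supBound
  rw [Real.sq_sqrt]
  have h0 : 0 ≤ u ⬝ᵥ u := by
    have : u ⬝ᵥ u = ∑ n, u n ^ 2 := by simp [dotProduct, sq]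
    rw [this]; exact Finset.sum_nonneg fun n _ => sq_nonneg (u n)
  have h1 : (0 : ℝ) ≤ (N + 1) * (2 / L) := by positivity
  exact mul_nonneg h0 h1

/-- The sup-norm bound: `|θ_u(x)| ≤ M_u` (every `x`; from `profile_sq_le`). [folklore] -/
theorem abs_profile_le_supBound (hL : 0 < L) (u : Fin (N + 1) → ℝ) (x : ℝ) :
    |profile L u x| ≤ supBound L u := by
  have h := profile_sq_le L hL u x
  have h2 : |profile L u x| = Real.sqrt (profile L u x ^ 2) := (Real.sqrt_sq_eq_abs _).symm
  rw [h2]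
  exact Real.sqrt_le_sqrt h

/-- Pointwise: `−m ≤ θ ≤ M`, `0 ≤ m` ⇒ `θ² ≤ M θ + m (M + m)` (`(θ+m)(θ−M−m) ≤ 0`). [folklore] -/
theorem sq_le_of_floor {θ m M : ℝ} (hm : 0 ≤ m) (hlo : -m ≤ θ) (hhi : θ ≤ M) :
    θ ^ 2 ≤ M * θ + m * (M + m) := by
  nlinarith [mul_nonneg (show 0 ≤ θ + m by linarith) (show 0 ≤ M + m - θ by linarith)]

/-- Parseval with a floor: `θ_u ≥ −m` on the window ⇒ `u ⬝ᵥ u ≤ M_u ∫θ_u + m (M_u + m) L`. [folklore] -/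
theorem dot_le_of_floor (hL : 0 < L) (u : Fin (N + 1) → ℝ) {m : ℝ} (hm : 0 ≤ m)
    (hfl : ∀ x ∈ Icc (-(L / 2)) (L / 2), -m ≤ profile L u x) :
    u ⬝ᵥ u ≤ supBound L u * (∫ x in -(L / 2)..(L / 2), profile L u x) + m * (supBound L u + m) * L := by
  have hab : -(L / 2) ≤ L / 2 := by linarith
  have hcp := continuous_profile L u
  set M := supBound L u with hMdef
  have hM0 : 0 ≤ M := supBound_nonneg L u
  rw [← integral_profile_sq L hL u]
  have hi1 : IntervalIntegrable (fun x => profile L u x ^ 2) volume (-(L / 2)) (L / 2) := by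
    apply Continuous.intervalIntegrable; exact hcp.pow 2
  have hi2 : IntervalIntegrable (fun x => M * profile L u x + m * (M + m)) volume (-(L / 2)) (L / 2) := by
    apply Continuous.intervalIntegrable; exact (continuous_const.mul hcp).add continuous_const
  have hmono : (∫ x in -(L / 2)..(L / 2), profile L u x ^ 2)
      ≤ ∫ x in -(L / 2)..(L / 2), (M * profile L u x + m * (M + m)) := by
    apply intervalIntegral.integral_mono_on hab hi1 hi2
    intro x hx
    have habs := abs_profile_le_supBound L hL u x
    exact sq_le_of_floor hm (hfl x hx) (le_trans (le_abs_self _) habs)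
  have hsplit : (∫ x in -(L / 2)..(L / 2), (M * profile L u x + m * (M + m)))
      = M * (∫ x in -(L / 2)..(L / 2), profile L u x) + m * (M + m) * L := by
    have hi3 : IntervalIntegrable (fun x => M * profile L u x) volume (-(L / 2)) (L / 2) := by
      apply Continuous.intervalIntegrable; exact continuous_const.mul hcp
    have hi4 : IntervalIntegrable (fun _ : ℝ => m * (M + m)) volume (-(L / 2)) (L / 2) :=
      intervalIntegrable_const
    rw [intervalIntegral.integral_add hi3 hi4, intervalIntegral.integral_const_mul,
      intervalIntegral.integral_const, smul_eq_mul]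
    ring
  linarith [hmono, hsplit]

/-- `⟨c, u⟩ = ∫ θ_u cosh(ηx)` (the profile is even). [folklore] -/
theorem realPairVec_dotProduct_cosh (η : ℝ) (u : Fin (N + 1) → ℝ) :
    realPairVec η L N ⬝ᵥ u = ∫ x in -(L / 2)..(L / 2), profile L u x * Real.cosh (η * x) := by
  have hcp := continuous_profile L u
  have hsym : ∫ x in -(L / 2)..(L / 2), profile L u x * Real.exp (-(η * x))
      = ∫ x in -(L / 2)..(L / 2), profile L u x * Real.exp (η * x) := by
    have h := intervalIntegral.integral_comp_neg (a := -(L / 2)) (b := L / 2)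
      (f := fun x => profile L u x * Real.exp (η * x))
    simp only [neg_neg] at h
    rw [← h]
    congr 1; funext x; rw [profile_neg, mul_neg]
  rw [realPairVec_dotProduct]
  have h2 : (fun x => profile L u x * Real.cosh (η * x))
      = fun x => (profile L u x * Real.exp (η * x) + profile L u x * Real.exp (-(η * x))) / 2 := by
    funext x; rw [Real.cosh_eq]; ring
  have hi1 : IntervalIntegrable (fun x => profile L u x * Real.exp (η * x)) volume (-(L / 2)) (L / 2) := by
    apply Continuous.intervalIntegrable; exact hcp.mul (by fun_prop)
  have hi2 : IntervalIntegrable (fun x => profile L u x * Real.exp (-(η * x))) volume (-(L / 2)) (L / 2) := by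
    apply Continuous.intervalIntegrable; exact hcp.mul (by fun_prop)
  rw [h2, intervalIntegral.integral_div, intervalIntegral.integral_add hi1 hi2, hsym]
  ring

/-- `cosh(ηx) − 1 ≤ G := cosh(η L/2) − 1` on the window. [folklore] -/
theorem cosh_sub_one_le {η x : ℝ} (hx : x ∈ Icc (-(L / 2)) (L / 2)) (hL : 0 < L) :
    Real.cosh (η * x) - 1 ≤ Real.cosh (η * (L / 2)) - 1 := by
  have h : Real.cosh (η * x) ≤ Real.cosh (η * (L / 2)) := by
    rw [Real.cosh_le_cosh, abs_mul, abs_mul]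
    apply mul_le_mul_of_nonneg_left _ (abs_nonneg η)
    rw [abs_of_pos (by linarith : (0:ℝ) < L / 2)]
    exact abs_le.mpr ⟨hx.1, hx.2⟩
  linarith

/-- With a floor: `θ_u ≥ −m` on the window ⇒ `∫ θ_u − m G L ≤ ⟨c, u⟩`, `G = cosh(η L/2) − 1`. [folklore] -/
theorem integral_sub_le_dot_of_floor (hL : 0 < L) (η : ℝ) (u : Fin (N + 1) → ℝ) {m : ℝ} (hm : 0 ≤ m)
    (hfl : ∀ x ∈ Icc (-(L / 2)) (L / 2), -m ≤ profile L u x) :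
    (∫ x in -(L / 2)..(L / 2), profile L u x) - m * (Real.cosh (η * (L / 2)) - 1) * L
      ≤ realPairVec η L N ⬝ᵥ u := by
  have hab : -(L / 2) ≤ L / 2 := by linarith
  have hcp := continuous_profile L u
  set G := Real.cosh (η * (L / 2)) - 1 with hG
  have hG0 : 0 ≤ G := by rw [hG]; linarith [Real.one_le_cosh (η * (L / 2))]
  rw [realPairVec_dotProduct_cosh L η u]
  have hi1 : IntervalIntegrable (fun x => profile L u x - m * G) volume (-(L / 2)) (L / 2) := by
    apply Continuous.intervalIntegrable; exact hcp.sub continuous_const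
  have hi2 : IntervalIntegrable (fun x => profile L u x * Real.cosh (η * x)) volume (-(L / 2)) (L / 2) := by
    apply Continuous.intervalIntegrable; exact hcp.mul (by fun_prop)
  have hmono : (∫ x in -(L / 2)..(L / 2), (profile L u x - m * G))
      ≤ ∫ x in -(L / 2)..(L / 2), profile L u x * Real.cosh (η * x) := by
    apply intervalIntegral.integral_mono_on hab hi1 hi2
    intro x hx
    have hc1 : 0 ≤ Real.cosh (η * x) - 1 := by linarith [Real.one_le_cosh (η * x)]
    have hc2 : Real.cosh (η * x) - 1 ≤ G := cosh_sub_one_le L hx hL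
    -- θ cosh = θ + θ (cosh − 1) ≥ θ − m (cosh − 1) ≥ θ − m G
    have h3 : -m * (Real.cosh (η * x) - 1) ≤ profile L u x * (Real.cosh (η * x) - 1) :=
      mul_le_mul_of_nonneg_right (hfl x hx) hc1
    have h4 : m * (Real.cosh (η * x) - 1) ≤ m * G := mul_le_mul_of_nonneg_left hc2 hm
    nlinarith [h3, h4]
  have hsplit : (∫ x in -(L / 2)..(L / 2), (profile L u x - m * G))
      = (∫ x in -(L / 2)..(L / 2), profile L u x) - m * G * L := by
    rw [intervalIntegral.integral_sub (hcp.intervalIntegrable _ _) intervalIntegrable_const,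
      intervalIntegral.integral_const, smul_eq_mul]
    ring
  linarith [hmono, hsplit]

/-- **MAIN INEQUALITY WITH A FLOOR.** `Q` a nonnegative form, `σ ≥ 0`, `u ≠ 0` an eigenvector of `Q + σ c cᵀ` with
eigenvalue `λ`; if `θ_u ≥ −τ M_u` on the window with `0 ≤ τ` and `τ (1 + τ + G) ≤ 1/(2(N+1))` (`G = cosh(η L/2) − 1`),
then `2 σ (N+1) L (1/(2(N+1)) − τ (1+τ+G))² ≤ λ`. [folklore] -/
theorem le_eigenvalue_of_floor (hL : 0 < L) (Q : Matrix (Fin (N + 1)) (Fin (N + 1)) ℝ)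
    (hQ : ∀ v, 0 ≤ v ⬝ᵥ (Q *ᵥ v)) {σ lam : ℝ} (η : ℝ) (hσ : 0 ≤ σ) (u : Fin (N + 1) → ℝ) (hu0 : u ≠ 0)
    (hu : (Q + σ • vecMulVec (realPairVec η L N) (realPairVec η L N)) *ᵥ u = lam • u)
    {τ : ℝ} (hτ : 0 ≤ τ) (hτs : τ * (1 + τ + (Real.cosh (η * (L / 2)) - 1)) ≤ 1 / (2 * (N + 1)))
    (hfl : ∀ x ∈ Icc (-(L / 2)) (L / 2), -(τ * supBound L u) ≤ profile L u x) :
    2 * σ * (N + 1) * L * (1 / (2 * (N + 1)) - τ * (1 + τ + (Real.cosh (η * (L / 2)) - 1))) ^ 2 ≤ lam := by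
  set c := realPairVec η L N with hc
  set G := Real.cosh (η * (L / 2)) - 1 with hG
  set M := supBound L u with hM
  set K : ℝ := (N + 1) * (2 / L) with hK
  set I := ∫ x in -(L / 2)..(L / 2), profile L u x with hI
  set B := c ⬝ᵥ u with hB
  have hG0 : 0 ≤ G := by rw [hG]; linarith [Real.one_le_cosh (η * (L / 2))]
  have hN1 : (0 : ℝ) < N + 1 := by positivity
  have hK0 : 0 < K := mul_pos hN1 (div_pos two_pos hL)
  have huu : 0 < u ⬝ᵥ u := dotProduct_self_pos hu0
  have hMsq : M ^ 2 = (u ⬝ᵥ u) * K := supBound_sq L hL u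
  have hM0 : 0 < M := by
    have h0 : 0 ≤ M := supBound_nonneg L u
    rcases h0.lt_or_eq with h | h
    · exact h
    · exfalso; have : M ^ 2 = 0 := by rw [← h]; ring
      rw [hMsq] at this; exact (mul_pos huu hK0).ne' this
  have hm : 0 ≤ τ * M := mul_nonneg hτ hM0.le
  -- (1) Parseval with floor: |u|² ≤ M I + τM (M + τM) L
  have h1 : u ⬝ᵥ u ≤ M * I + τ * M * (M + τ * M) * L := dot_le_of_floor L hL u hm hfl
  -- (2) cosh comparison with floor: I − τ M G L ≤ B
  have h2 : I - τ * M * G * L ≤ B := integral_sub_le_dot_of_floor L hL η u hm hfl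
  -- (3) eigen-inequality: σ B² ≤ λ |u|²
  have h3 : σ * B ^ 2 ≤ lam * (u ⬝ᵥ u) := sigma_sq_dot_le Q hQ c u hu
  -- (4) B ≥ M β with β = L (1/(2(N+1)) − τ(1+τ+G)) ≥ 0
  set β : ℝ := L * (1 / (2 * (N + 1)) - τ * (1 + τ + G)) with hβ
  have hβ0 : 0 ≤ β := by
    rw [hβ]; exact mul_nonneg hL.le (by linarith)
  have hKinv : (u ⬝ᵥ u) = M ^ 2 * (L / (2 * (N + 1))) := by
    rw [hMsq, hK]; field_simp
  have h4 : M * β ≤ B := by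
    -- from h1: M I ≥ |u|² − τ M (M+τM) L = M² L/(2(N+1)) − τ(1+τ) M² L, divide by M
    have h5 : M * (M * (L / (2 * (N + 1))) - τ * (1 + τ) * M * L) ≤ M * I := by
      have : M ^ 2 * (L / (2 * (N + 1))) ≤ M * I + τ * M * (M + τ * M) * L := by rw [← hKinv]; exact h1
      nlinarith [this]
    have h6 : M * (L / (2 * (N + 1))) - τ * (1 + τ) * M * L ≤ I := le_of_mul_le_mul_left h5 hM0
    have h7 : M * β = M * (L / (2 * (N + 1))) - τ * (1 + τ) * M * L - τ * M * G * L := by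
      rw [hβ]; ring
    linarith [h6, h2, h7]
  have hB0 : 0 ≤ B := le_trans (mul_nonneg hM0.le hβ0) h4
  have h8 : M ^ 2 * β ^ 2 ≤ B ^ 2 := by
    rw [← mul_pow]; exact pow_le_pow_left₀ (mul_nonneg hM0.le hβ0) h4 2
  -- (5) combine: σ M² β² ≤ λ |u|² = λ M² L/(2(N+1))
  have h9 : σ * (M ^ 2 * β ^ 2) ≤ lam * (M ^ 2 * (L / (2 * (N + 1)))) := by
    calc σ * (M ^ 2 * β ^ 2) ≤ σ * B ^ 2 := mul_le_mul_of_nonneg_left h8 hσ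
      _ ≤ lam * (u ⬝ᵥ u) := h3
      _ = lam * (M ^ 2 * (L / (2 * (N + 1)))) := by rw [hKinv]
  have hM2 : 0 < M ^ 2 := by positivity
  have h10 : σ * β ^ 2 ≤ lam * (L / (2 * (N + 1))) := by
    have : M ^ 2 * (σ * β ^ 2) ≤ M ^ 2 * (lam * (L / (2 * (N + 1)))) := by nlinarith [h9]
    exact le_of_mul_le_mul_left this hM2
  have h11 : σ * β ^ 2 = (2 * σ * (N + 1) * L * (1 / (2 * (N + 1)) - τ * (1 + τ + G)) ^ 2)
      * (L / (2 * (N + 1))) := by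
    rw [hβ]; field_simp
  rw [h11] at h10
  exact le_of_mul_le_mul_right h10 (div_pos hL (by positivity))

/-- The depth threshold `2 σ (N+1) L (1/(2(N+1)) − τ (1+τ+G))²`, `G = cosh(η L/2) − 1`; at `τ = 0` it equals
`σ L / (2 (N+1))`. -/
def depthThreshold (σ η τ : ℝ) (N : ℕ) : ℝ :=
  2 * σ * (N + 1) * L * (1 / (2 * (N + 1)) - τ * (1 + τ + (Real.cosh (η * (L / 2)) - 1))) ^ 2

/-- At `τ = 0` the depth threshold is the one-signed threshold `σ L / (2 (N+1))`. [folklore] -/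
theorem depthThreshold_zero (σ η : ℝ) (N : ℕ) : depthThreshold L σ η 0 N = σ * L / (2 * (N + 1)) := by
  unfold depthThreshold
  have hN1 : (2 : ℝ) * (N + 1) ≠ 0 := by positivity
  field_simp
  ring

/-- **DEPTH, negative side.** Eigenvalue below the depth threshold ⇒ the profile dips BELOW `−τ M_u` somewhere on the
window (`M_u ≥ max |θ_u|`, so the relative depth exceeds `τ`). [folklore] -/
theorem exists_profile_lt_of_eigenvalue_lt (hL : 0 < L) (Q : Matrix (Fin (N + 1)) (Fin (N + 1)) ℝ)
    (hQ : ∀ v, 0 ≤ v ⬝ᵥ (Q *ᵥ v)) {σ lam : ℝ} (η : ℝ) (hσ : 0 ≤ σ) (u : Fin (N + 1) → ℝ) (hu0 : u ≠ 0)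
    (hu : (Q + σ • vecMulVec (realPairVec η L N) (realPairVec η L N)) *ᵥ u = lam • u)
    {τ : ℝ} (hτ : 0 ≤ τ) (hτs : τ * (1 + τ + (Real.cosh (η * (L / 2)) - 1)) ≤ 1 / (2 * (N + 1)))
    (hlam : lam < depthThreshold L σ η τ N) :
    ∃ x ∈ Icc (-(L / 2)) (L / 2), profile L u x < -(τ * supBound L u) := by
  by_contra h
  push Not at h
  exact absurd (le_eigenvalue_of_floor L hL Q hQ η hσ u hu0 hu hτ hτs h) (not_le.mpr hlam)

/-- **DEPTH, positive side.** Same hypothesis ⇒ the profile also rises ABOVE `+τ M_u` somewhere (apply the negative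
side to `−u`). [folklore] -/
theorem exists_profile_gt_of_eigenvalue_lt (hL : 0 < L) (Q : Matrix (Fin (N + 1)) (Fin (N + 1)) ℝ)
    (hQ : ∀ v, 0 ≤ v ⬝ᵥ (Q *ᵥ v)) {σ lam : ℝ} (η : ℝ) (hσ : 0 ≤ σ) (u : Fin (N + 1) → ℝ) (hu0 : u ≠ 0)
    (hu : (Q + σ • vecMulVec (realPairVec η L N) (realPairVec η L N)) *ᵥ u = lam • u)
    {τ : ℝ} (hτ : 0 ≤ τ) (hτs : τ * (1 + τ + (Real.cosh (η * (L / 2)) - 1)) ≤ 1 / (2 * (N + 1)))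
    (hlam : lam < depthThreshold L σ η τ N) :
    ∃ x ∈ Icc (-(L / 2)) (L / 2), τ * supBound L u < profile L u x := by
  have hu' : (Q + σ • vecMulVec (realPairVec η L N) (realPairVec η L N)) *ᵥ (-u) = lam • (-u) := by
    rw [mulVec_neg, hu, smul_neg]
  obtain ⟨x, hx, hlt⟩ :=
    exists_profile_lt_of_eigenvalue_lt L hL Q hQ η hσ (-u) (neg_ne_zero.mpr hu0) hu' hτ hτs hlam
  refine ⟨x, hx, ?_⟩
  rw [profile_neg_vec, supBound_neg] at hlt
  linarith

/-- DEEP NODALITY at relative depth `τ`: the profile exceeds `+τ M_u` somewhere and goes below `−τ M_u` somewhere on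
the window, `M_u = supBound L u ≥ max|θ_u|`.  This implies the harness's floor-aware sign change at floor `τ`
(which normalises by `max|θ_u| ≤ M_u`). -/
def DeepNodal (τ : ℝ) (u : Fin (N + 1) → ℝ) : Prop :=
  (∃ x ∈ Icc (-(L / 2)) (L / 2), τ * supBound L u < profile L u x) ∧
  (∃ x ∈ Icc (-(L / 2)) (L / 2), profile L u x < -(τ * supBound L u))

/-- **DEPTH THEOREM.** Eigenvalue below `depthThreshold L σ η τ N` ⇒ `DeepNodal L τ u`. [folklore] -/
theorem deepNodal_of_eigenvalue_lt (hL : 0 < L) (Q : Matrix (Fin (N + 1)) (Fin (N + 1)) ℝ)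
    (hQ : ∀ v, 0 ≤ v ⬝ᵥ (Q *ᵥ v)) {σ lam : ℝ} (η : ℝ) (hσ : 0 ≤ σ) (u : Fin (N + 1) → ℝ) (hu0 : u ≠ 0)
    (hu : (Q + σ • vecMulVec (realPairVec η L N) (realPairVec η L N)) *ᵥ u = lam • u)
    {τ : ℝ} (hτ : 0 ≤ τ) (hτs : τ * (1 + τ + (Real.cosh (η * (L / 2)) - 1)) ≤ 1 / (2 * (N + 1)))
    (hlam : lam < depthThreshold L σ η τ N) : DeepNodal L τ u :=
  ⟨exists_profile_gt_of_eigenvalue_lt L hL Q hQ η hσ u hu0 hu hτ hτs hlam,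
   exists_profile_lt_of_eigenvalue_lt L hL Q hQ η hσ u hu0 hu hτ hτs hlam⟩

/-- A deeply nodal vector (any `τ ≥ 0`) is not one-signed. [folklore] -/
theorem not_oneSigned_of_deepNodal {τ : ℝ} (hτ : 0 ≤ τ) {u : Fin (N + 1) → ℝ} (h : DeepNodal L τ u) :
    ¬ OneSigned L u := by
  obtain ⟨⟨x, hx, hgt⟩, ⟨y, hy, hlt⟩⟩ := h
  have hM := mul_nonneg hτ (supBound_nonneg L u)
  rintro (hpos | hneg)
  · linarith [hpos y hy]
  · linarith [hneg x hx]

end Depth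

section DatumLevel

/-- Datum level.  For a datum whose block at `win` is ζ's block plus `σ c cᵀ` (`c = realPairVec η (2a) N`), ζ's block a
nonnegative form there, and bottom Rayleigh value below `depthThreshold (2a) σ η τ N` (`0 ≤ τ`, `τ(1+τ+G) ≤ 1/(2(N+1))`):
EVERY bottom vector of the datum at `win` is deeply nodal at relative depth `τ` — the floor-aware harness reading
(floor `τ = 10⁻²⁰`) of REALPAIR-EVEN-NODAL. [folklore] -/
theorem realPair_deepNodal_bottom (win : Window) (hζ : ∀ v, 0 ≤ v ⬝ᵥ (zetaDatum win *ᵥ v))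
    {σ : ℝ} (η : ℝ) (hσ : 0 ≤ σ) (d : Datum)
    (hd : d win = zetaDatum win
      + σ • vecMulVec (realPairVec η (2 * win.a) win.N) (realPairVec η (2 * win.a) win.N))
    {τ : ℝ} (hτ : 0 ≤ τ)
    (hτs : τ * (1 + τ + (Real.cosh (η * (2 * win.a / 2)) - 1)) ≤ 1 / (2 * (win.N + 1)))
    (hlam : bottomRayleigh (d win) < depthThreshold (2 * win.a) σ η τ win.N)
    {u : Fin (win.N + 1) → ℝ} (hb : IsBottomVector (d win) u) : DeepNodal (2 * win.a) τ u := by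
  have hL : 0 < 2 * win.a := by linarith [win.ha]
  have hu : (zetaDatum win + σ • vecMulVec (realPairVec η (2 * win.a) win.N) (realPairVec η (2 * win.a) win.N))
      *ᵥ u = bottomRayleigh (d win) • u := by rw [← hd]; exact hb.2
  exact deepNodal_of_eigenvalue_lt (2 * win.a) hL (zetaDatum win) hζ η hσ u hb.1 hu hτ hτs hlam

end DatumLevel

end Summit.RiemannHypothesis.RiemannHypothesis.Theorems.PfPersistenceF2NodalDepth

end
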